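import Summits.HodgeConjecture.HodgeConjecture.Theorems.MarkmanPartnerTransportPartnerExistenceBBFNondegenerate
import Mathlib.LinearAlgebra.BilinearForm.Orthogonal

/-!
# Route MarkmanPartnerTransport · support `PartnerExistence` (stmt-HodgeConjecture-19655) —
# the rational Néron–Severi and transcendental spaces of a marked `K3^{[2]}`-type fourfold

For a marked smooth projective fourfold `(X, φ, P, z)` (clauses (m1)–(m6) of the route's targets) the
marking `φ : H²(X(ℂ); ℂ) ≅ ℂ²³` identifies the rational classes with `ℚ²³`
(`isRationalClass_iff_of_markedSq`), so `N¹(X) = algebraicClasses X 1` — spanned by rational classes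
(`supportedClasses_eq_span_isRationalClass`) — has a RATIONAL FORM
`N_ℚ = {v ∈ ℚ²³ : φ⁻¹ v ∈ N¹(X)}` with `N_ℚ ⊗ ℂ = φ(N¹(X))`, `dim_ℚ N_ℚ = ρ(X)`.  Its orthogonal
`T_ℚ = N_ℚ^⊥` for the rational Beauville–Bogomolov form `q = Matrix.toBilin' (Λ₂₃ ⊗ ℚ)` is the rational
transcendental space: by the non-degeneracy of `q` on `N¹(X)`
(`BBFPositivity.k3HilbertForm_radical_algebraicClasses_one_eq_zero`) `N_ℚ ∩ T_ℚ = 0`, so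
`ℚ²³ = N_ℚ ⊕ T_ℚ`, `q|_{T_ℚ}` is non-degenerate, `dim T_ℚ = 23 − ρ(X)`, and `T_ℚ ⊗ ℂ` is exactly the
space of `q`-transcendental vectors `{y : q(y, φ N¹(X)) = 0}` (= `φ(T(X)_ℂ)`, the `IsBBFTransc` of the
route), which contains the period `z` and `z̄`.  Finally the "irreducibility" input of the partner
construction: **a rational transcendental vector orthogonal to the period is zero** (it is a rational
`(1,1)`-class, algebraic by Lefschetz `(1,1)`, hence in `N_ℚ ∩ T_ℚ = 0`).

All statements take the rational Néron–Severi space as a CHARACTERISED parameter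
`(NQ, hNQ : ∀ v, v ∈ NQ ↔ φ⁻¹(v) ∈ N¹(X))` (`exists_ratNeronSeveri` supplies it), so that users may
realise it as they wish.  These are the lattice-theoretic inputs (T(X)_ℚ as a regular rational quadratic
space of dimension `23 − ρ`, with its period) for the Hasse–Minkowski / period-surjectivity proof plan of
`PartnerExistence`.

* `isRationalClass_iff_of_markedSq`, `exists_ratNeronSeveri`, `span_ratNeronSeveri`,
  `finrank_ratNeronSeveri`;
* `bbfTransc_iff_ratNeronSeveri`, `ratCast_bbfTransc_iff_mem_orthogonal`,
  `ratNeronSeveri_inf_orthogonal_eq_bot`, `isCompl_ratNeronSeveri_orthogonal`,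
  `restrict_ratTransc_nondegenerate`, `finrank_ratTransc`;
* (sequel `…PartnerExistenceLatticeTransc`: `T_ℚ ⊗ ℂ` = the `q`-transcendental vectors, the period,
  irreducibility).

No definition, no sorry, no named fact. Prover seat hodge-nonav-19652-p1 (gen 5), `--supports stmt-HodgeConjecture-19655`.

References: D. Huybrechts, *Lectures on K3 Surfaces*, Ch. 3 Def. 2.5, Lemma 3.1 (transcendental
lattice, irreducibility); C. Voisin, *Hodge Theory I*, §7.1.1 and Thm. 11.30; A. Beauville,
J. Differential Geom. 18 (1983) §8–9.
-/

noncomputable section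

set_option linter.dupNamespace false

open Module CategoryTheory
open Literature.AlgebraicTopology.SingularHomology Literature.Geometry.Kaehler
open Literature.AlgebraicGeometry Literature.AlgebraicGeometry.Motives Literature.AlgebraicGeometry.HodgeTheory
open Literature.AlgebraicGeometry.Hyperkaehler Literature.AlgebraicGeometry.Surfaces
open Summit.HodgeConjecture.HodgeConjecture.Theorems.NikulinTwinTransport
open Summit.HodgeConjecture.HodgeConjecture.Theorems.MarkmanPartnerTransport.BBFPositivity

namespace Summit.HodgeConjecture.HodgeConjecture.Theorems.MarkmanPartnerTransport.PartnerLattice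

variable {X : SchemeOver ℂ}

/-- `MarkedK3Sq[X, φ, P, z]`: VERBATIM the `let MarkedK3Sq := …` binder of the route declarations of
MarkmanPartnerTransport (clauses (m1)–(m6)). Local notation only. -/
local notation3 (prettyPrint := false) "MarkedK3Sq[" X ", " φ ", " P ", " z "]" =>
  (((IsIntegralClass P ∧ ∀ Q : complexBetti X (2 * 4), IsIntegralClass Q → ∃ n : ℤ, Q = n • P) ∧
    (∀ c : complexBetti X 2, IsIntegralClass c ↔ ∃ v : K3HilbertIndex → ℤ, φ c = fun i => (v i : ℂ)) ∧
    (∀ a : complexBetti X 2, cupPowTwo a 4 = ((3 : ℂ) * (k3HilbertForm 2 (φ a) (φ a)) ^ 2) • P) ∧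
    (IsOfHodgeType 4 X 2 2 0 (LinearEquiv.symm φ z) ∧
      ∀ τ : complexBetti X 2, IsOfHodgeType 4 X 2 2 0 τ → ∃ t : ℂ, τ = t • LinearEquiv.symm φ z) ∧
    (∀ c : complexBetti X 2, IsOfHodgeType 4 X 2 1 1 c ↔
      (k3HilbertForm 2 (φ c) z = 0 ∧ k3HilbertForm 2 (φ c) (star z) = 0)) ∧
    (k3HilbertForm 2 z z = 0 ∧ 0 < (k3HilbertForm 2 (star z) z).re)))

/-- `qQ` = the rational Beauville–Bogomolov form of `K3^{[2]}`-type on `ℚ²³`. Local notation only. -/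
local notation3 (prettyPrint := false) "qQ" => Matrix.toBilin' (Matrix.map (k3HilbertGram 2) (Int.cast : ℤ → ℚ))

/-- `qC` = the complex Beauville–Bogomolov form on `ℂ²³` as a Mathlib bilinear form. Local notation only. -/
local notation3 (prettyPrint := false) "qC" => Matrix.toBilin' (Matrix.map (k3HilbertGram 2) (Int.cast : ℤ → ℂ))

/-! ### The rational and complex forms -/

/-- The complex `K3^{[2]}` form on rational vectors is the rational form. [folklore] -/
theorem k3HilbertForm_ratCast (a b : K3HilbertIndex → ℚ) :
    k3HilbertForm 2 (fun i => (a i : ℂ)) (fun i => (b i : ℂ)) = ((qQ a b : ℚ) : ℂ) := by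
  rw [Matrix.toBilin'_apply, k3HilbertForm_apply]
  simp only [Matrix.map_apply, Rat.cast_sum, Rat.cast_mul, Rat.cast_intCast]

/-- `qC` is the `K3^{[2]}` form `k3HilbertForm 2`. [folklore] -/
theorem qC_apply (a b : K3HilbertIndex → ℂ) : qC a b = k3HilbertForm 2 a b := by
  rw [Matrix.toBilin'_apply, k3HilbertForm_apply]
  rfl

/-- **`q` is non-degenerate on `ℚ²³`** (`det Λ₂₃ = 2`). [cite: OGrady2008NumericalK3Square, §2.1 (2.1.2)] -/
theorem qQ_nondegenerate : (qQ).Nondegenerate := by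
  refine LinearMap.BilinForm.nondegenerate_toBilin'_of_det_ne_zero' _ ?_
  rw [← Int.cast_det, k3HilbertGram_two_det]
  norm_num

/-- **`q` is non-degenerate on `ℂ²³`.** [cite: OGrady2008NumericalK3Square, §2.1 (2.1.2)] -/
theorem qC_nondegenerate : (qC).Nondegenerate := by
  refine LinearMap.BilinForm.nondegenerate_toBilin'_of_det_ne_zero' _ ?_
  rw [← Int.cast_det, k3HilbertGram_two_det]
  norm_num

/-- `q` is symmetric on `ℚ²³`. [folklore] -/
theorem qQ_comm (a b : K3HilbertIndex → ℚ) : qQ a b = qQ b a := by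
  have h := (isSymm_toBilin'_map (R := ℚ) (k3HilbertGram 2) (k3HilbertGram_transpose 2)).eq a b
  simpa using h

/-- `q` is reflexive on `ℚ²³`. [folklore] -/
theorem qQ_isRefl : (qQ).IsRefl := fun a b h => by rw [qQ_comm]; exact h

/-- `q` is reflexive on `ℂ²³`. [folklore] -/
theorem qC_isRefl : (qC).IsRefl := fun a b h => by rw [qC_apply, k3HilbertForm_comm, ← qC_apply]; exact h

/-- `dim ℚ²³ = 23`. [cite: Beauville1983, §6 Prop. 6] -/
theorem finrank_rat23 : finrank ℚ (K3HilbertIndex → ℚ) = 23 := by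
  rw [finrank_fintype_fun_eq_card]
  rfl

/-- `dim ℂ²³ = 23`. [cite: Beauville1983, §6 Prop. 6] -/
theorem finrank_complex23 : finrank ℂ (K3HilbertIndex → ℂ) = 23 := by
  rw [finrank_fintype_fun_eq_card]
  rfl

/-- **`dim_ℂ (R ⊗ ℂ) = dim_ℚ R`** for a `ℚ`-subspace `R ⊆ ℚ^ι` (a `ℚ`-basis stays `ℂ`-linearly
independent, `linearIndependent_algebraMap_comp_iff`). [folklore] -/
theorem finrank_span_ratCast {ι : Type*} [Fintype ι] (R : Submodule ℚ (ι → ℚ)) :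
    finrank ℂ (Submodule.span ℂ
      ((fun a : ι → ℚ => fun i => (a i : ℂ)) '' (R : Set (ι → ℚ)))) = finrank ℚ R := by
  -- adapted from `NikulinTwinTransport.HkLatticeWitt.finrank_span_ratCast`
  classical
  let b := Module.finBasis ℚ R
  let f : Fin (finrank ℚ R) → ι → ℂ := fun k i => (((b k : R) : ι → ℚ) i : ℂ)
  have hli : LinearIndependent ℂ f := by
    have hb : LinearIndependent ℚ fun k => ((b k : R) : ι → ℚ) :=
      b.linearIndependent.map' R.subtype (Submodule.ker_subtype R)
    have h := (linearIndependent_algebraMap_comp_iff (S := ℂ)).2 hb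
    have hf : f = fun k => ⇑(algebraMap ℚ ℂ) ∘ ((b k : R) : ι → ℚ) := by
      funext k i
      simp only [f, Function.comp_apply, eq_ratCast]
    rw [hf]
    exact h
  have hspan : Submodule.span ℂ ((fun a : ι → ℚ => fun i => (a i : ℂ)) '' (R : Set (ι → ℚ))) =
      Submodule.span ℂ (Set.range f) := by
    apply le_antisymm
    · refine Submodule.span_le.2 ?_
      rintro _ ⟨a, ha, rfl⟩
      have ha' : (⟨a, ha⟩ : R) = ∑ k, b.repr ⟨a, ha⟩ k • b k := (b.sum_repr _).symm
      have hc : (fun i => (a i : ℂ)) = ∑ k, (b.repr ⟨a, ha⟩ k : ℂ) • f k := by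
        have h2 := congrArg (fun r : R => fun i => (((r : R) : ι → ℚ) i : ℂ)) ha'
        simp only at h2
        rw [h2]
        funext i
        simp only [f, Submodule.coe_sum, Submodule.coe_smul, Finset.sum_apply, Pi.smul_apply,
          Rat.cast_sum, Rat.cast_mul, smul_eq_mul]
      show (fun i => (a i : ℂ)) ∈ Submodule.span ℂ (Set.range f)
      rw [hc]
      exact Submodule.sum_mem _ fun k _ => Submodule.smul_mem _ _ (Submodule.subset_span ⟨k, rfl⟩)
    · refine Submodule.span_mono ?_
      rintro _ ⟨k, rfl⟩
      exact ⟨((b k : R) : ι → ℚ), (b k).2, rfl⟩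
  rw [hspan, finrank_span_eq_card hli, Fintype.card_fin]

/-! ### Rational classes in marking coordinates -/

/-- **Under the integral marking (m2), the rational classes of `H²(X(ℂ); ℂ)` are exactly `φ⁻¹(ℚ²³)`**
(rational classes have integral multiples, `IsRationalClass.exists_nsmul_isIntegralClass`; rational
vectors have integral multiples). [cite: VoisinHodgeI2002, §7.1.1] -/
theorem isRationalClass_iff_of_markedSq (hX : IsSmoothProjective 4 X)
    {φ : complexBetti X 2 ≃ₗ[ℂ] (K3HilbertIndex → ℂ)}
    (hint : ∀ c : complexBetti X 2, IsIntegralClass c ↔ ∃ v : K3HilbertIndex → ℤ, φ c = fun i => (v i : ℂ))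
    (c : complexBetti X 2) :
    IsRationalClass c ↔ ∃ w : K3HilbertIndex → ℚ, φ c = fun i => (w i : ℂ) := by
  -- adapted from `NikulinTwinTransport.isRationalClass_iff_of_integralMarking` (dimension 4, index `Λ₂₃`)
  constructor
  · intro hc
    obtain ⟨N, hN, hNc⟩ := hc.exists_nsmul_isIntegralClass hX
    obtain ⟨v, hv⟩ := (hint _).1 hNc
    refine ⟨fun i => (v i : ℚ) / N, ?_⟩
    have hN' : (N : ℂ) ≠ 0 := Nat.cast_ne_zero.2 hN.ne'
    rw [map_smul] at hv
    funext i
    have hi : (N : ℂ) * φ c i = (v i : ℂ) := by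
      have := congrFun hv i
      simpa only [Pi.smul_apply, smul_eq_mul] using this
    rw [Rat.cast_div, Rat.cast_intCast, Rat.cast_natCast, ← hi]
    field_simp
  · rintro ⟨w, hw⟩
    obtain ⟨⟨D, hD⟩, hDw⟩ := IsLocalization.exist_integer_multiples_of_finite (nonZeroDivisors ℤ) w
    choose m hm using hDw
    have hD0 : (D : ℤ) ≠ 0 := nonZeroDivisors.ne_zero hD
    have hDC : (D : ℂ) ≠ 0 := Int.cast_ne_zero.2 hD0
    have hm' : ∀ i, (m i : ℂ) = (D : ℂ) * (w i : ℂ) := fun i => by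
      have h1 : ((algebraMap ℤ ℚ) (m i) : ℂ) = (((D : ℤ) • w i : ℚ) : ℂ) := by rw [hm i]
      rw [zsmul_eq_mul, Rat.cast_mul, Rat.cast_intCast, eq_intCast, Rat.cast_intCast] at h1
      exact h1
    have hintc : IsIntegralClass ((D : ℂ) • c) := by
      refine (hint _).2 ⟨m, ?_⟩
      rw [map_smul, hw]
      funext i
      rw [Pi.smul_apply, smul_eq_mul, hm' i]
    have hc : c = (((D : ℚ)⁻¹ : ℚ) : ℂ) • ((D : ℂ) • c) := by
      rw [smul_smul, Rat.cast_inv, Rat.cast_intCast, inv_mul_cancel₀ hDC, one_smul]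
    rw [hc]
    exact hintc.isRationalClass.smul _

/-! ### The rational Néron–Severi space `N_ℚ` -/

/-- **The rational Néron–Severi space exists**: `N_ℚ = {v ∈ ℚ²³ : φ⁻¹ v ∈ N¹(X)}` is a
`ℚ`-subspace. [cite: Huybrechts2016K3, Ch. 1 §3.3 and Ch. 3 §2] -/
theorem exists_ratNeronSeveri (φ : complexBetti X 2 ≃ₗ[ℂ] (K3HilbertIndex → ℂ)) :
    ∃ NQ : Submodule ℚ (K3HilbertIndex → ℚ),
      ∀ v, v ∈ NQ ↔ φ.symm (fun i => (v i : ℂ)) ∈ algebraicClasses X 1 := by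
  refine ⟨{ carrier := {v | φ.symm (fun i => (v i : ℂ)) ∈ algebraicClasses X 1}
            add_mem' := fun {u v} hu hv => ?_
            zero_mem' := ?_
            smul_mem' := fun q v hv => ?_ }, fun v => Iff.rfl⟩
  · show φ.symm (fun i => ((u + v) i : ℂ)) ∈ algebraicClasses X 1
    rw [ratCastVec_add, map_add]
    exact Submodule.add_mem _ hu hv
  · show φ.symm (fun i => ((0 : K3HilbertIndex → ℚ) i : ℂ)) ∈ algebraicClasses X 1
    rw [ratCastVec_zero, map_zero]
    exact Submodule.zero_mem _
  · show φ.symm (fun i => ((q • v) i : ℂ)) ∈ algebraicClasses X 1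
    rw [ratCastVec_smul, map_smul]
    exact Submodule.smul_mem _ _ hv

section NS

variable {φ : complexBetti X 2 ≃ₗ[ℂ] (K3HilbertIndex → ℂ)} {P : complexBetti X (2 * 4)} {z : K3HilbertIndex → ℂ}
  {NQ : Submodule ℚ (K3HilbertIndex → ℚ)}

/-- **`N_ℚ ⊗ ℂ = φ(N¹(X))`**: `N¹(X)` is spanned by rational classes (`supportedClasses_eq_span_isRationalClass`),
which have rational coordinates. [cite: VoisinHodgeI2002, §7.1.1 and §11.1.2] -/
theorem span_ratNeronSeveri (hX : IsSmoothProjective 4 X)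
    (hint : ∀ c : complexBetti X 2, IsIntegralClass c ↔ ∃ v : K3HilbertIndex → ℤ, φ c = fun i => (v i : ℂ))
    (hNQ : ∀ v, v ∈ NQ ↔ φ.symm (fun i => (v i : ℂ)) ∈ algebraicClasses X 1) :
    Submodule.span ℂ ((fun a : K3HilbertIndex → ℚ => fun i => (a i : ℂ)) '' (NQ : Set (K3HilbertIndex → ℚ))) =
      (algebraicClasses X 1).map (φ : complexBetti X 2 →ₗ[ℂ] (K3HilbertIndex → ℂ)) := by
  apply le_antisymm
  · refine Submodule.span_le.2 ?_
    rintro _ ⟨a, ha, rfl⟩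
    rw [SetLike.mem_coe, Submodule.mem_map_equiv]
    exact (hNQ a).1 ha
  · have hspan := supportedClasses_eq_span_isRationalClass hX 2 1
    change algebraicClasses X 1 = Submodule.span ℂ
      {c : complexBetti X 2 | IsRationalClass c ∧ c ∈ algebraicClasses X 1} at hspan
    rw [hspan, Submodule.map_span, Submodule.span_le]
    rintro _ ⟨c, ⟨hcrat, hcN⟩, rfl⟩
    obtain ⟨w, hw⟩ := (isRationalClass_iff_of_markedSq hX hint c).1 hcrat
    refine Submodule.subset_span ⟨w, ?_, ?_⟩
    · rw [SetLike.mem_coe, hNQ, ← hw, LinearEquiv.symm_apply_apply]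
      exact hcN
    · exact hw.symm

/-- **`dim_ℚ N_ℚ = ρ(X) = dim_ℂ N¹(X)`.** [cite: VoisinHodgeI2002, §7.1.1] -/
theorem finrank_ratNeronSeveri (hX : IsSmoothProjective 4 X)
    (hint : ∀ c : complexBetti X 2, IsIntegralClass c ↔ ∃ v : K3HilbertIndex → ℤ, φ c = fun i => (v i : ℂ))
    (hNQ : ∀ v, v ∈ NQ ↔ φ.symm (fun i => (v i : ℂ)) ∈ algebraicClasses X 1) :
    finrank ℚ NQ = finrank ℂ (algebraicClasses X 1) := by
  rw [← finrank_span_ratCast NQ, span_ratNeronSeveri hX hint hNQ, LinearEquiv.finrank_map_eq]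

/-- **`q`-transcendence is tested on `N_ℚ`**: a vector `y ∈ ℂ²³` is `q`-orthogonal to `φ(N¹(X))` iff it is
`q`-orthogonal to the rational vectors of `N_ℚ`. [cite: Huybrechts2016K3, Ch. 3 Def. 2.5] -/
theorem bbfTransc_iff_ratNeronSeveri (hX : IsSmoothProjective 4 X)
    (hint : ∀ c : complexBetti X 2, IsIntegralClass c ↔ ∃ v : K3HilbertIndex → ℤ, φ c = fun i => (v i : ℂ))
    (hNQ : ∀ v, v ∈ NQ ↔ φ.symm (fun i => (v i : ℂ)) ∈ algebraicClasses X 1) (y : K3HilbertIndex → ℂ) :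
    (∀ d ∈ algebraicClasses X 1, k3HilbertForm 2 y (φ d) = 0) ↔
      ∀ n ∈ NQ, k3HilbertForm 2 y (fun i => (n i : ℂ)) = 0 := by
  constructor
  · intro h n hn
    have h1 := h _ ((hNQ n).1 hn)
    rwa [LinearEquiv.apply_symm_apply] at h1
  · intro h d hd
    have hle : Submodule.span ℂ ((fun a : K3HilbertIndex → ℚ => fun i => (a i : ℂ)) ''
        (NQ : Set (K3HilbertIndex → ℚ))) ≤ LinearMap.ker (qC y) := by
      refine Submodule.span_le.2 ?_
      rintro _ ⟨n, hn, rfl⟩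
      rw [SetLike.mem_coe, LinearMap.mem_ker, qC_apply]
      exact h n hn
    have hmem : φ d ∈ (algebraicClasses X 1).map (φ : complexBetti X 2 →ₗ[ℂ] (K3HilbertIndex → ℂ)) := by
      rw [Submodule.mem_map_equiv, LinearEquiv.symm_apply_apply]
      exact hd
    rw [← span_ratNeronSeveri hX hint hNQ] at hmem
    have h2 := hle hmem
    rwa [LinearMap.mem_ker, qC_apply] at h2

/-- **For rational vectors, `q`-transcendence is membership in `T_ℚ = N_ℚ^⊥`.**
[cite: Huybrechts2016K3, Ch. 3 Def. 2.5] -/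
theorem ratCast_bbfTransc_iff_mem_orthogonal (hX : IsSmoothProjective 4 X)
    (hint : ∀ c : complexBetti X 2, IsIntegralClass c ↔ ∃ v : K3HilbertIndex → ℤ, φ c = fun i => (v i : ℂ))
    (hNQ : ∀ v, v ∈ NQ ↔ φ.symm (fun i => (v i : ℂ)) ∈ algebraicClasses X 1) (v : K3HilbertIndex → ℚ) :
    (∀ d ∈ algebraicClasses X 1, k3HilbertForm 2 (fun i => (v i : ℂ)) (φ d) = 0) ↔
      v ∈ (qQ).orthogonal NQ := by
  rw [bbfTransc_iff_ratNeronSeveri hX hint hNQ, LinearMap.BilinForm.mem_orthogonal_iff]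
  refine forall₂_congr fun n hn => ?_
  rw [qQ_comm n v, k3HilbertForm_ratCast, Rat.cast_eq_zero]

/-- **`N_ℚ ∩ N_ℚ^⊥ = 0`**: the Beauville–Bogomolov form is non-degenerate on `N¹(X)`
(`BBFPositivity.k3HilbertForm_radical_algebraicClasses_one_eq_zero`). [cite: Beauville1983, §8 Thm. 5]
[cite: VoisinHodgeI2002, §6.3.2 Thm. 6.32] -/
theorem ratNeronSeveri_inf_orthogonal_eq_bot (hX : IsSmoothProjective 4 X) (hM : MarkedK3Sq[X, φ, P, z])
    (hNQ : ∀ v, v ∈ NQ ↔ φ.symm (fun i => (v i : ℂ)) ∈ algebraicClasses X 1) :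
    NQ ⊓ (qQ).orthogonal NQ = ⊥ := by
  obtain ⟨-, hint, -⟩ := id hM
  rw [eq_bot_iff]
  intro v hv
  obtain ⟨hvN, hvT⟩ := Submodule.mem_inf.1 hv
  rw [Submodule.mem_bot]
  have hc : φ.symm (fun i => (v i : ℂ)) ∈ algebraicClasses X 1 := (hNQ v).1 hvN
  have hperp : ∀ d ∈ algebraicClasses X 1,
      k3HilbertForm 2 (φ (φ.symm (fun i => (v i : ℂ)))) (φ d) = 0 := by
    intro d hd
    rw [LinearEquiv.apply_symm_apply]
    exact (ratCast_bbfTransc_iff_mem_orthogonal hX hint hNQ v).2 hvT d hd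
  have h0 := k3HilbertForm_radical_algebraicClasses_one_eq_zero hX hM hc hperp
  have h1 : (fun i => (v i : ℂ)) = fun i => (((0 : K3HilbertIndex → ℚ) i : ℚ) : ℂ) := by
    rw [ratCastVec_zero, ← LinearEquiv.map_eq_zero_iff φ.symm, h0]
  exact ratCastVec_injective h1

/-- **`ℚ²³ = N_ℚ ⊕ T_ℚ`.** [cite: Huybrechts2016K3, Ch. 3 Def. 2.5 and Lemma 3.1] -/
theorem isCompl_ratNeronSeveri_orthogonal (hX : IsSmoothProjective 4 X) (hM : MarkedK3Sq[X, φ, P, z])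
    (hNQ : ∀ v, v ∈ NQ ↔ φ.symm (fun i => (v i : ℂ)) ∈ algebraicClasses X 1) :
    IsCompl NQ ((qQ).orthogonal NQ) :=
  (LinearMap.BilinForm.restrict_nondegenerate_iff_isCompl_orthogonal qQ_isRefl).1
    (LinearMap.BilinForm.nondegenerate_restrict_of_disjoint_orthogonal _ qQ_isRefl
      (disjoint_iff.2 (ratNeronSeveri_inf_orthogonal_eq_bot hX hM hNQ)))

/-- **`T_ℚ^⊥ = N_ℚ`.** [cite: Huybrechts2016K3, Ch. 3 Lemma 3.1] -/
theorem orthogonal_ratTransc (NQ : Submodule ℚ (K3HilbertIndex → ℚ)) :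
    (qQ).orthogonal ((qQ).orthogonal NQ) = NQ :=
  LinearMap.BilinForm.orthogonal_orthogonal qQ_nondegenerate qQ_isRefl NQ

/-- **`q|_{T_ℚ}` is non-degenerate** (`T_ℚ ∩ T_ℚ^⊥ = T_ℚ ∩ N_ℚ = 0`). [cite: Huybrechts2016K3, Ch. 3 Lemma 3.1] -/
theorem restrict_ratTransc_nondegenerate (hX : IsSmoothProjective 4 X) (hM : MarkedK3Sq[X, φ, P, z])
    (hNQ : ∀ v, v ∈ NQ ↔ φ.symm (fun i => (v i : ℂ)) ∈ algebraicClasses X 1) :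
    ((qQ).restrict ((qQ).orthogonal NQ)).Nondegenerate := by
  refine LinearMap.BilinForm.nondegenerate_restrict_of_disjoint_orthogonal _ qQ_isRefl (disjoint_iff.2 ?_)
  rw [orthogonal_ratTransc, inf_comm]
  exact ratNeronSeveri_inf_orthogonal_eq_bot hX hM hNQ

/-- **`dim_ℚ T_ℚ = 23 − ρ(X)`.** [cite: Huybrechts2016K3, Ch. 3 Def. 2.5] [cite: Beauville1983, §6 Prop. 6] -/
theorem finrank_ratTransc (hX : IsSmoothProjective 4 X)
    (hint : ∀ c : complexBetti X 2, IsIntegralClass c ↔ ∃ v : K3HilbertIndex → ℤ, φ c = fun i => (v i : ℂ))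
    (hNQ : ∀ v, v ∈ NQ ↔ φ.symm (fun i => (v i : ℂ)) ∈ algebraicClasses X 1) :
    finrank ℚ ((qQ).orthogonal NQ) = 23 - finrank ℂ (algebraicClasses X 1) := by
  rw [LinearMap.BilinForm.finrank_orthogonal qQ_nondegenerate, finrank_rat23,
    finrank_ratNeronSeveri hX hint hNQ]

end NS

end Summit.HodgeConjecture.HodgeConjecture.Theorems.MarkmanPartnerTransport.PartnerLattice

end
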